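/-
COR-CM (cell pub-hodgecm2, stage 2 of the Hodge ladder) — count-neutral KERNEL CENSUS TRANSPORT, degree 12, type ℤ/6×ℤ/2 (seat
prover-pub-hodgecm2-b23-g33-0, binder prover b23, gen 33; claim INT2-INTRINSIC addendum DEG12-GENERATORS; sequel of
`CorCM/FaceCensusOrbitTransversal.lean` and `Census/DuodecicFaceGeneratorsC6C2.lean`). Theorems only: four closed `Bool` side
checks decided in the kernel (`decide +kernel`: `sideChecks` and the transversal cover `coverTrans`) against the orbit-equivariant
census data of `Census/DuodecicFaceGeneratorsC6C2.lean` (`Γ`, `genReps`, `certs` — used BY NAME) and the resulting field-closure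
theorems. No definition, no named fact, nothing asserted; `Interfaces.lean` (C1), every E term, B01 and `Transposition/*` are
untouched. HONEST FRAMING (COORDINATOR RULING — HODGE FRAMING CORRECTION, 2026-08-21T11:55:35Z): `HC_CM` is NOT proved, here or
anywhere in the tree. Every closing theorem below is CONDITIONAL on face-period witnesses (for ONE field, on the listed faces); no
period is proved here.
T5 (coordinator ruling 15:33:56Z (3), lead staging l.4095): the census binders of the transport are DISCHARGED here by `decide`
(`sideChecks`); the dictionary binders (`e`, `hmul`, `hconj` / `ε`, `hε`, `c`) say «Gal(K/ℚ) ≅ this type with complex conjugation ↦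
`Γ.conj`» and are inhabited by every Galois CM field of this type (the intrinsic sequel derives them from a `MulEquiv`); the face-reading
binders are INHABITED IN THE KERNEL for every such enumeration (`exists_faces_duodecicC6C2` below, from `FaceCensus.exists_face_reads`);
the only remaining hypotheses are the period witnesses / Weil-line algebraicity on the listed faces = instances of the crux
(`FacePeriodExists` / B01-S), against which the tree has no `¬` theorem on the universe of record — no contradiction derivable; checker:
self (prover-pub-hodgecm2-b23-g33-0), 2026-08-21.
-/
import Summits.HodgeConjecture.CorCM.FaceCensusOrbitTransversal
import Summits.HodgeConjecture.CorCM.Census.DuodecicFaceGeneratorsC6C2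
import HarnessLib

/-!
# Degree 12, abelian type `ℤ/6×ℤ/2`: 6 face periods per field close its slice (census transport)

Census transport instance (`FaceCensus.hgen_of_certOK_cover`, `CorCM/FaceCensusOrbitTransport.lean`) for the Galois CM closure
type `(ℤ/6×ℤ/2, c = (3,0))` — e.g. `ℚ(ζ₂₁)`, `ℚ(ζ₂₈)`, `ℚ(ζ₃₆)`, `ℚ(ζ₇)·k`, `ℚ(ζ₉)·k` — with the generating data of
`Census/DuodecicFaceGeneratorsC6C2.lean` (6 generating orbits of 22). The four side checks of the orbit-equivariant transport by
`decide +kernel` (`sideChecks`: orbit cells, pair labels, certified faces, cover); the generation binder `hgen(𝒮, σ₀)` of INT2-GEN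
for every set `𝒮` of faces of a Galois CM field `K` of this type containing faces that READ AS the generating representatives
under an enumeration `e : GalT K ≃ Fin 12` of the table; non-vacuity of those readings; and the CLOSED field-closure theorems on
the universe of record — period witnesses (or algebraic Weil lines) on those 6 faces ⟹ the Hodge conjecture, in every codimension,
for every complex abelian variety dominated by a finite product of abelian varieties realising CM types of CM fields embeddable in
`K` — in the `GalT` form and in the AUTOMORPHISM form (`ε : Aut(K) ≃ Fin 12`; bridge `FaceCensus.exists_enum_of_autEnum`). `HC_CM`
is NOT proved and nothing here produces a period.

References: [cite: Pohlmann1968, Thm. 1]; [cite: Milne1999LefschetzClasses, Thm. 3.2 and Cor. 4.5];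
[cite: Shimura1998, §6.2 Theorem 3 and §6.1 Corollary of Theorem 2 (pp. 41–43)]; [cite: MumfordAV1970, §19 Thm. 1 and p. 169].
-/

noncomputable section

open CategoryTheory NumberField NumberField.ComplexEmbedding
open Literature.AlgebraicGeometry Literature.AlgebraicGeometry.Motives Literature.AlgebraicGeometry.HodgeTheory
open Literature.AlgebraicGeometry.ComplexMultiplication Literature.AlgebraicGeometry.Milne1999
open Literature.NumberTheory.Automorphic
open Literature.NumberTheory.Automorphic.PicardCM
open Summit.HodgeConjecture.CorCM.Domination

namespace Summit.HodgeConjecture.CorCM.DuodecicFaceTransport.C6C2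

open Summit.HodgeConjecture.CorCM.Census.FaceSquaresModel (mem flipAt)
open Summit.HodgeConjecture.CorCM.Census.DuodecicFaceGeneratorsC6C2 (Γ genReps certs)

set_option maxRecDepth 16384 in
set_option maxHeartbeats 4000000 in -- three closed kernel evaluations over the certificate data of this type
/-- **Side checks 1–3 of the orbit-equivariant transport, type `ℤ/6 × ℤ/2` with `c = (3, 0)` (index `3`)** (bundled with the
representative list so that the statement is type-specific): (1) ORBIT CELLS — every generator face of the certificates is one of
the eight faces of an explicit orbit cell of a generating representative; (2) PAIR LABELS — every divisor-pair label is a CM type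
of the model; (3) CERTIFIED FACES — every certified face is a face of the model satisfying `certOK` over the generating
representatives. [folklore] -/
theorem sideChecks : genReps = [(455, 9, 18), (455, 9, 36), (455, 9, 1152), (462, 18, 2304), (462, 36, 1152), (469, 9, 1152)] ∧
    (certs.all fun c => c.2.1.all fun gi => genReps.any fun r => (List.finRange 12).any fun j =>
    [(Γ.twist j r.1, Γ.twist j r.2.1, Γ.twist j r.2.2),
      (flipAt (Γ.twist j r.2.1) (Γ.twist j r.1), Γ.twist j r.2.1, Γ.twist j r.2.2),
      (flipAt (Γ.twist j r.2.2) (Γ.twist j r.1), Γ.twist j r.2.1, Γ.twist j r.2.2),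
      (flipAt (Γ.twist j r.2.2) (flipAt (Γ.twist j r.2.1) (Γ.twist j r.1)), Γ.twist j r.2.1, Γ.twist j r.2.2),
      (Γ.twist j r.1, Γ.twist j r.2.2, Γ.twist j r.2.1),
      (flipAt (Γ.twist j r.2.1) (Γ.twist j r.1), Γ.twist j r.2.2, Γ.twist j r.2.1),
      (flipAt (Γ.twist j r.2.2) (Γ.twist j r.1), Γ.twist j r.2.2, Γ.twist j r.2.1),
      (flipAt (Γ.twist j r.2.2) (flipAt (Γ.twist j r.2.1) (Γ.twist j r.1)), Γ.twist j r.2.2, Γ.twist j r.2.1)].contains gi.1)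
      = true ∧
    (certs.all fun c => c.2.2.all fun pj => Γ.isCMType pj.1) = true ∧
    (certs.all fun c => Γ.faces.contains c.1 && Γ.certOK genReps c.1 c.2.1 c.2.2) = true := by
  refine ⟨rfl, ?_, ?_, ?_⟩ <;> decide +kernel

set_option maxRecDepth 16384 in
set_option maxHeartbeats 4000000 in -- two closed kernel evaluations: 64 types × 12 twists; the faces over the transversal against the twist list
/-- **Side check 4 (COVER on a transversal, list form), type `ℤ/6 × ℤ/2` with `c = (3, 0)` (index `3`):** (a) every CM type of the
model is carried by some Galois twist into the transversal `[455, 462, 469, 476, 490, 504, 1365, 1386]` of the twist-blocks of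
types; (b) the normalised corner set of every face of the model WITH TYPE IN THE TRANSVERSAL lies in the precomputed list of the
normalised corner sets of the Galois twists of the certified faces (`FaceCensus.hgen_of_certOK_coverTrans`,
`CorCM/FaceCensusOrbitTransversal.lean`, moves every other face there by a base change). [folklore] -/
theorem coverTrans : genReps = [(455, 9, 18), (455, 9, 36), (455, 9, 1152), (462, 18, 2304), (462, 36, 1152), (469, 9, 1152)] ∧
    (Γ.cmTypes.all fun T => (List.finRange 12).any fun j => ([455, 462, 469, 476, 490, 504, 1365, 1386] : List ℕ).contains (Γ.twist j T)) = true ∧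
    (Γ.faces.all fun φ => !(([455, 462, 469, 476, 490, 504, 1365, 1386] : List ℕ).contains φ.1) || (certs.flatMap fun c => (List.finRange 12).map fun j =>
        Census.FaceSquaresModel.normalize (Γ.corners (Γ.twist j c.1.1, Γ.twist j c.1.2.1, Γ.twist j c.1.2.2))).contains
      (Census.FaceSquaresModel.normalize (Γ.corners φ))) = true := by
  refine ⟨rfl, ?_, ?_⟩ <;> decide +kernel

/-- **The generation binder, type `ℤ/6 × ℤ/2` with `c = (3, 0)` (index `3`).** `K` a Galois CM field with an enumeration `e : GalT K ≃
Fin 12` of its Galois translates, multiplicative for b30's table and with `e conjT = 3`; `σ₀` a base embedding; `𝒮` any set of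
faces of `K` containing faces READING AS the 6 generating representative codes `(455, 9, 18)` (type `{0,1,2,6,7,8}`, places
`{0,3}`, `{1,4}`), `(455, 9, 36)` (type `{0,1,2,6,7,8}`, places `{0,3}`, `{2,5}`), `(455, 9, 1152)` (type `{0,1,2,6,7,8}`, places
`{0,3}`, `{7,10}`), `(462, 18, 2304)` (type `{1,2,3,6,7,8}`, places `{1,4}`, `{8,11}`), `(462, 36, 1152)` (type `{1,2,3,6,7,8}`,
places `{2,5}`, `{7,10}`), `(469, 9, 1152)` (type `{0,2,4,6,7,8}`, places `{0,3}`, `{7,10}`) — `σ₀ ∘ P ∈ R.Φ ↔ e P ∈` the type,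
`R.p`, `R.p′` at the two places. Then `hgen(𝒮, σ₀)` holds at every face (orbit-equivariant certificates of
`Census/DuodecicFaceGeneratorsC6C2.lean`: 6 orbits of the 22 generate). [cite: Pohlmann1968, Thm. 1] [cite:
Milne1999LefschetzClasses, Thm. 3.2] -/
theorem hgen_duodecicC6C2 (K : CMField) [IsGalois ℚ K] (e : GalT K ≃ Fin 12)
    (hmul : ∀ P Q : GalT K, e (P * Q) = Γ.mul (e P) (e Q)) (hconj : e conjT = Γ.conj) (σ₀ : (K : Type) →+* ℂ)
    (𝒮 : Set (Face K))
    (h₁ : ∃ R ∈ 𝒮, (∀ P : GalT K, P.1 σ₀ ∈ R.Φ.1 ↔ mem (e P) 455 = true) ∧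
      Γ.placeMask (e (translate σ₀ R.p)) = 9 ∧ Γ.placeMask (e (translate σ₀ R.p')) = 18)
    (h₂ : ∃ R ∈ 𝒮, (∀ P : GalT K, P.1 σ₀ ∈ R.Φ.1 ↔ mem (e P) 455 = true) ∧
      Γ.placeMask (e (translate σ₀ R.p)) = 9 ∧ Γ.placeMask (e (translate σ₀ R.p')) = 36)
    (h₃ : ∃ R ∈ 𝒮, (∀ P : GalT K, P.1 σ₀ ∈ R.Φ.1 ↔ mem (e P) 455 = true) ∧
      Γ.placeMask (e (translate σ₀ R.p)) = 9 ∧ Γ.placeMask (e (translate σ₀ R.p')) = 1152)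
    (h₄ : ∃ R ∈ 𝒮, (∀ P : GalT K, P.1 σ₀ ∈ R.Φ.1 ↔ mem (e P) 462 = true) ∧
      Γ.placeMask (e (translate σ₀ R.p)) = 18 ∧ Γ.placeMask (e (translate σ₀ R.p')) = 2304)
    (h₅ : ∃ R ∈ 𝒮, (∀ P : GalT K, P.1 σ₀ ∈ R.Φ.1 ↔ mem (e P) 462 = true) ∧
      Γ.placeMask (e (translate σ₀ R.p)) = 36 ∧ Γ.placeMask (e (translate σ₀ R.p')) = 1152)
    (h₆ : ∃ R ∈ 𝒮, (∀ P : GalT K, P.1 σ₀ ∈ R.Φ.1 ↔ mem (e P) 469 = true) ∧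
      Γ.placeMask (e (translate σ₀ R.p)) = 9 ∧ Γ.placeMask (e (translate σ₀ R.p')) = 1152) (f : Face K) :
    lefChar f.corner (fun _ => ({σ₀} : Finset ((K : Type) →+* ℂ))) ∈ AddSubgroup.closure
      {a : Asym K | ∃ g ∈ 𝒮, ∃ σ : (K : Type) →+* ℂ, a = lefChar g.corner (fun _ => ({σ} : Finset ((K : Type) →+* ℂ)))} := by
  refine FaceCensus.hgen_of_certOK_coverTrans Γ e hmul hconj genReps certs sideChecks.2.2.2 [455, 462, 469, 476, 490, 504, 1365, 1386] coverTrans.2.1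
    coverTrans.2.2 sideChecks.2.1 sideChecks.2.2.1 σ₀ 𝒮 ?_ f
  intro r hr
  have hr' : r = (455, 9, 18) ∨ r = (455, 9, 36) ∨ r = (455, 9, 1152) ∨ r = (462, 18, 2304) ∨ r = (462, 36, 1152) ∨ r = (469, 9, 1152) := by simpa [genReps] using hr
  rcases hr' with rfl | rfl | rfl | rfl | rfl | rfl
  · obtain ⟨R, hRS, hΦ, hp, hq⟩ := h₁
    exact ⟨R, hRS, ⟨by decide, fun i => by rw [mem_pullType, hΦ, e.apply_symm_apply]⟩, hp, hq⟩
  · obtain ⟨R, hRS, hΦ, hp, hq⟩ := h₂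
    exact ⟨R, hRS, ⟨by decide, fun i => by rw [mem_pullType, hΦ, e.apply_symm_apply]⟩, hp, hq⟩
  · obtain ⟨R, hRS, hΦ, hp, hq⟩ := h₃
    exact ⟨R, hRS, ⟨by decide, fun i => by rw [mem_pullType, hΦ, e.apply_symm_apply]⟩, hp, hq⟩
  · obtain ⟨R, hRS, hΦ, hp, hq⟩ := h₄
    exact ⟨R, hRS, ⟨by decide, fun i => by rw [mem_pullType, hΦ, e.apply_symm_apply]⟩, hp, hq⟩
  · obtain ⟨R, hRS, hΦ, hp, hq⟩ := h₅
    exact ⟨R, hRS, ⟨by decide, fun i => by rw [mem_pullType, hΦ, e.apply_symm_apply]⟩, hp, hq⟩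
  · obtain ⟨R, hRS, hΦ, hp, hq⟩ := h₆
    exact ⟨R, hRS, ⟨by decide, fun i => by rw [mem_pullType, hΦ, e.apply_symm_apply]⟩, hp, hq⟩

set_option maxRecDepth 16384 in
/-- **Non-vacuity, type `ℤ/6 × ℤ/2` with `c = (3, 0)` (index `3`):** under any such enumeration, faces of `K` reading as the
generating representative codes EXIST (`FaceCensus.exists_face_reads`; the codes lie in `Γ.faces` by `decide`). [folklore] -/
theorem exists_faces_duodecicC6C2 (K : CMField) [IsGalois ℚ K] (e : GalT K ≃ Fin 12)
    (hmul : ∀ P Q : GalT K, e (P * Q) = Γ.mul (e P) (e Q)) (hconj : e conjT = Γ.conj) (σ₀ : (K : Type) →+* ℂ) :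
    ∃ R₁ R₂ R₃ R₄ R₅ R₆ : Face K,
      ((∀ P : GalT K, P.1 σ₀ ∈ R₁.Φ.1 ↔ mem (e P) 455 = true) ∧
      Γ.placeMask (e (translate σ₀ R₁.p)) = 9 ∧ Γ.placeMask (e (translate σ₀ R₁.p')) = 18) ∧
      ((∀ P : GalT K, P.1 σ₀ ∈ R₂.Φ.1 ↔ mem (e P) 455 = true) ∧
      Γ.placeMask (e (translate σ₀ R₂.p)) = 9 ∧ Γ.placeMask (e (translate σ₀ R₂.p')) = 36) ∧
      ((∀ P : GalT K, P.1 σ₀ ∈ R₃.Φ.1 ↔ mem (e P) 455 = true) ∧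
      Γ.placeMask (e (translate σ₀ R₃.p)) = 9 ∧ Γ.placeMask (e (translate σ₀ R₃.p')) = 1152) ∧
      ((∀ P : GalT K, P.1 σ₀ ∈ R₄.Φ.1 ↔ mem (e P) 462 = true) ∧
      Γ.placeMask (e (translate σ₀ R₄.p)) = 18 ∧ Γ.placeMask (e (translate σ₀ R₄.p')) = 2304) ∧
      ((∀ P : GalT K, P.1 σ₀ ∈ R₅.Φ.1 ↔ mem (e P) 462 = true) ∧
      Γ.placeMask (e (translate σ₀ R₅.p)) = 36 ∧ Γ.placeMask (e (translate σ₀ R₅.p')) = 1152) ∧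
      ((∀ P : GalT K, P.1 σ₀ ∈ R₆.Φ.1 ↔ mem (e P) 469 = true) ∧
      Γ.placeMask (e (translate σ₀ R₆.p)) = 9 ∧ Γ.placeMask (e (translate σ₀ R₆.p')) = 1152) := by
  obtain ⟨R₁, hT₁, hp₁, hq₁⟩ := FaceCensus.exists_face_reads Γ e hmul hconj σ₀ (r := (455, 9, 18))
    (by decide +kernel)
  obtain ⟨R₂, hT₂, hp₂, hq₂⟩ := FaceCensus.exists_face_reads Γ e hmul hconj σ₀ (r := (455, 9, 36))
    (by decide +kernel)
  obtain ⟨R₃, hT₃, hp₃, hq₃⟩ := FaceCensus.exists_face_reads Γ e hmul hconj σ₀ (r := (455, 9, 1152))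
    (by decide +kernel)
  obtain ⟨R₄, hT₄, hp₄, hq₄⟩ := FaceCensus.exists_face_reads Γ e hmul hconj σ₀ (r := (462, 18, 2304))
    (by decide +kernel)
  obtain ⟨R₅, hT₅, hp₅, hq₅⟩ := FaceCensus.exists_face_reads Γ e hmul hconj σ₀ (r := (462, 36, 1152))
    (by decide +kernel)
  obtain ⟨R₆, hT₆, hp₆, hq₆⟩ := FaceCensus.exists_face_reads Γ e hmul hconj σ₀ (r := (469, 9, 1152))
    (by decide +kernel)
  exact ⟨R₁, R₂, R₃, R₄, R₅, R₆, ⟨fun P => by rw [← mem_pullType, ← e.symm_apply_apply P, ← hT₁.2 (e P), e.symm_apply_apply],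
    hp₁, hq₁⟩, ⟨fun P => by rw [← mem_pullType, ← e.symm_apply_apply P, ← hT₂.2 (e P), e.symm_apply_apply],
    hp₂, hq₂⟩, ⟨fun P => by rw [← mem_pullType, ← e.symm_apply_apply P, ← hT₃.2 (e P), e.symm_apply_apply],
    hp₃, hq₃⟩, ⟨fun P => by rw [← mem_pullType, ← e.symm_apply_apply P, ← hT₄.2 (e P), e.symm_apply_apply],
    hp₄, hq₄⟩, ⟨fun P => by rw [← mem_pullType, ← e.symm_apply_apply P, ← hT₅.2 (e P), e.symm_apply_apply],
    hp₅, hq₅⟩, ⟨fun P => by rw [← mem_pullType, ← e.symm_apply_apply P, ← hT₆.2 (e P), e.symm_apply_apply],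
    hp₆, hq₆⟩⟩

/-- **FIELD CLOSURE, type `ℤ/6 × ℤ/2` with `c = (3, 0)` (index `3`) — period-witness form, CLOSED (headline).** `K`, `e`, `σ₀` as
above and 6 faces of `K` reading as the generating representatives; ONE period witness for each on the universe of record (some
admissible `ι₁`, some hermitian 3-space, some level, eigenforms at some `σ`) implies the Hodge conjecture, in every codimension,
for every complex abelian variety dominated by a finite product of abelian varieties realising CM types of CM fields embeddable in
`K`. (FRAMING: conditional on these 6 face periods; `HC_CM` is not proved.) [cite: Shimura1998, §6.2 Theorem 3 and §6.1 Corollary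
of Theorem 2 (pp. 41–43)] [cite: Pohlmann1968, Thm. 1] [cite: Milne1999LefschetzClasses, Thm. 3.2 and Cor. 4.5] [cite:
MumfordAV1970, §19 Thm. 1 and p. 169] -/
theorem hodgeConjectureFor_of_avDominatedBy_isProductOf_of_facePeriod_duodecicC6C2 (K : CMField) [IsGalois ℚ K]
    (e : GalT K ≃ Fin 12) (hmul : ∀ P Q : GalT K, e (P * Q) = Γ.mul (e P) (e Q)) (hconj : e conjT = Γ.conj)
    (σ₀ : (K : Type) →+* ℂ) (R₁ R₂ R₃ R₄ R₅ R₆ : Face K)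
    (hR₁ : (∀ P : GalT K, P.1 σ₀ ∈ R₁.Φ.1 ↔ mem (e P) 455 = true) ∧
      Γ.placeMask (e (translate σ₀ R₁.p)) = 9 ∧ Γ.placeMask (e (translate σ₀ R₁.p')) = 18)
    (hR₂ : (∀ P : GalT K, P.1 σ₀ ∈ R₂.Φ.1 ↔ mem (e P) 455 = true) ∧
      Γ.placeMask (e (translate σ₀ R₂.p)) = 9 ∧ Γ.placeMask (e (translate σ₀ R₂.p')) = 36)
    (hR₃ : (∀ P : GalT K, P.1 σ₀ ∈ R₃.Φ.1 ↔ mem (e P) 455 = true) ∧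
      Γ.placeMask (e (translate σ₀ R₃.p)) = 9 ∧ Γ.placeMask (e (translate σ₀ R₃.p')) = 1152)
    (hR₄ : (∀ P : GalT K, P.1 σ₀ ∈ R₄.Φ.1 ↔ mem (e P) 462 = true) ∧
      Γ.placeMask (e (translate σ₀ R₄.p)) = 18 ∧ Γ.placeMask (e (translate σ₀ R₄.p')) = 2304)
    (hR₅ : (∀ P : GalT K, P.1 σ₀ ∈ R₅.Φ.1 ↔ mem (e P) 462 = true) ∧
      Γ.placeMask (e (translate σ₀ R₅.p)) = 36 ∧ Γ.placeMask (e (translate σ₀ R₅.p')) = 1152)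
    (hR₆ : (∀ P : GalT K, P.1 σ₀ ∈ R₆.Φ.1 ↔ mem (e P) 469 = true) ∧
      Γ.placeMask (e (translate σ₀ R₆.p)) = 9 ∧ Γ.placeMask (e (translate σ₀ R₆.p')) = 1152)
    (h₁ : ∃ ι₁ : K →+* ℂ, R₁.Admissible ι₁ ∧ ∃ (V : HermSpace3 K ι₁) (σ : K →+* ℂ),
      (Model.picardCMUniverse exists_isReal_hodgeModel_holds hodgePQ_independent_of_hodgeModel_holds
        BallQuotient.ballQuotientUniformised_holds cmAbelianVarietyRealised_holds).PeriodNV ι₁ V K R₁.psi σ)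
    (h₂ : ∃ ι₁ : K →+* ℂ, R₂.Admissible ι₁ ∧ ∃ (V : HermSpace3 K ι₁) (σ : K →+* ℂ),
      (Model.picardCMUniverse exists_isReal_hodgeModel_holds hodgePQ_independent_of_hodgeModel_holds
        BallQuotient.ballQuotientUniformised_holds cmAbelianVarietyRealised_holds).PeriodNV ι₁ V K R₂.psi σ)
    (h₃ : ∃ ι₁ : K →+* ℂ, R₃.Admissible ι₁ ∧ ∃ (V : HermSpace3 K ι₁) (σ : K →+* ℂ),
      (Model.picardCMUniverse exists_isReal_hodgeModel_holds hodgePQ_independent_of_hodgeModel_holds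
        BallQuotient.ballQuotientUniformised_holds cmAbelianVarietyRealised_holds).PeriodNV ι₁ V K R₃.psi σ)
    (h₄ : ∃ ι₁ : K →+* ℂ, R₄.Admissible ι₁ ∧ ∃ (V : HermSpace3 K ι₁) (σ : K →+* ℂ),
      (Model.picardCMUniverse exists_isReal_hodgeModel_holds hodgePQ_independent_of_hodgeModel_holds
        BallQuotient.ballQuotientUniformised_holds cmAbelianVarietyRealised_holds).PeriodNV ι₁ V K R₄.psi σ)
    (h₅ : ∃ ι₁ : K →+* ℂ, R₅.Admissible ι₁ ∧ ∃ (V : HermSpace3 K ι₁) (σ : K →+* ℂ),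
      (Model.picardCMUniverse exists_isReal_hodgeModel_holds hodgePQ_independent_of_hodgeModel_holds
        BallQuotient.ballQuotientUniformised_holds cmAbelianVarietyRealised_holds).PeriodNV ι₁ V K R₅.psi σ)
    (h₆ : ∃ ι₁ : K →+* ℂ, R₆.Admissible ι₁ ∧ ∃ (V : HermSpace3 K ι₁) (σ : K →+* ℂ),
      (Model.picardCMUniverse exists_isReal_hodgeModel_holds hodgePQ_independent_of_hodgeModel_holds
        BallQuotient.ballQuotientUniformised_holds cmAbelianVarietyRealised_holds).PeriodNV ι₁ V K R₆.psi σ)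
    {P A : AbelianVariety ℂ} (hP : AbelianVariety.IsProductOf (fun B : AbelianVariety ℂ =>
      ∃ (E : Type) (_ : Field E) (_ : NumberField E) (_ : IsCMField E) (_ : E →+* (K : Type)) (Φ : CMType E)
        (ι : 𝓞 E →+* End B) (θ : E →+* Module.End ℂ (complexBetti B.X 1)),
        IsCMTypeRealisation Φ B ι θ) P)
    (hA : AVDominatedBy A P) : HodgeConjectureFor A.dim A.X :=
  hodgeConjectureFor_of_avDominatedBy_isProductOf_of_exists_facePeriod_on K
    ((show 6 ≤ 12 by decide).trans_eq (FaceCensus.eq_finrank_of_enum e)) {R₁, R₂, R₃, R₄, R₅, R₆} σ₀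
    (hgen_duodecicC6C2 K e hmul hconj σ₀ {R₁, R₂, R₃, R₄, R₅, R₆} ⟨R₁, by simp, hR₁⟩ ⟨R₂, by simp, hR₂⟩ ⟨R₃, by simp, hR₃⟩ ⟨R₄, by simp, hR₄⟩ ⟨R₅, by simp, hR₅⟩ ⟨R₆, by simp, hR₆⟩)
    (fun f hf => by
      simp only [Set.mem_insert_iff, Set.mem_singleton_iff] at hf
      rcases hf with rfl | rfl | rfl | rfl | rfl | rfl
      · exact h₁
      · exact h₂
      · exact h₃
      · exact h₄
      · exact h₅
      · exact h₆) hP hA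


/-- **FIELD CLOSURE, type `ℤ/6 × ℤ/2` with `c = (3, 0)` (index `3`) — Weil-line form, CLOSED.** Same dictionary data; if the Weil
lines of the listed faces are algebraic on the universe of record, the same conclusion holds. [cite: Pohlmann1968, Thm. 1] [cite:
Milne1999LefschetzClasses, Thm. 3.2 and Cor. 4.5] [cite: Shimura1998, §6.2 Theorem 3 and §6.1 Corollary of Theorem 2 (pp. 41–43)] -/
theorem hodgeConjectureFor_of_avDominatedBy_isProductOf_of_weilFaceAlgebraic_duodecicC6C2 (K : CMField) [IsGalois ℚ K]
    (e : GalT K ≃ Fin 12) (hmul : ∀ P Q : GalT K, e (P * Q) = Γ.mul (e P) (e Q)) (hconj : e conjT = Γ.conj)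
    (σ₀ : (K : Type) →+* ℂ) (R₁ R₂ R₃ R₄ R₅ R₆ : Face K)
    (hR₁ : (∀ P : GalT K, P.1 σ₀ ∈ R₁.Φ.1 ↔ mem (e P) 455 = true) ∧
      Γ.placeMask (e (translate σ₀ R₁.p)) = 9 ∧ Γ.placeMask (e (translate σ₀ R₁.p')) = 18)
    (hR₂ : (∀ P : GalT K, P.1 σ₀ ∈ R₂.Φ.1 ↔ mem (e P) 455 = true) ∧
      Γ.placeMask (e (translate σ₀ R₂.p)) = 9 ∧ Γ.placeMask (e (translate σ₀ R₂.p')) = 36)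
    (hR₃ : (∀ P : GalT K, P.1 σ₀ ∈ R₃.Φ.1 ↔ mem (e P) 455 = true) ∧
      Γ.placeMask (e (translate σ₀ R₃.p)) = 9 ∧ Γ.placeMask (e (translate σ₀ R₃.p')) = 1152)
    (hR₄ : (∀ P : GalT K, P.1 σ₀ ∈ R₄.Φ.1 ↔ mem (e P) 462 = true) ∧
      Γ.placeMask (e (translate σ₀ R₄.p)) = 18 ∧ Γ.placeMask (e (translate σ₀ R₄.p')) = 2304)
    (hR₅ : (∀ P : GalT K, P.1 σ₀ ∈ R₅.Φ.1 ↔ mem (e P) 462 = true) ∧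
      Γ.placeMask (e (translate σ₀ R₅.p)) = 36 ∧ Γ.placeMask (e (translate σ₀ R₅.p')) = 1152)
    (hR₆ : (∀ P : GalT K, P.1 σ₀ ∈ R₆.Φ.1 ↔ mem (e P) 469 = true) ∧
      Γ.placeMask (e (translate σ₀ R₆.p)) = 9 ∧ Γ.placeMask (e (translate σ₀ R₆.p')) = 1152)
    (hW₁ : (Model.picardCMUniverse exists_isReal_hodgeModel_holds hodgePQ_independent_of_hodgeModel_holds
      BallQuotient.ballQuotientUniformised_holds cmAbelianVarietyRealised_holds).WeilFaceAlgebraic K R₁)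
    (hW₂ : (Model.picardCMUniverse exists_isReal_hodgeModel_holds hodgePQ_independent_of_hodgeModel_holds
      BallQuotient.ballQuotientUniformised_holds cmAbelianVarietyRealised_holds).WeilFaceAlgebraic K R₂)
    (hW₃ : (Model.picardCMUniverse exists_isReal_hodgeModel_holds hodgePQ_independent_of_hodgeModel_holds
      BallQuotient.ballQuotientUniformised_holds cmAbelianVarietyRealised_holds).WeilFaceAlgebraic K R₃)
    (hW₄ : (Model.picardCMUniverse exists_isReal_hodgeModel_holds hodgePQ_independent_of_hodgeModel_holds
      BallQuotient.ballQuotientUniformised_holds cmAbelianVarietyRealised_holds).WeilFaceAlgebraic K R₄)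
    (hW₅ : (Model.picardCMUniverse exists_isReal_hodgeModel_holds hodgePQ_independent_of_hodgeModel_holds
      BallQuotient.ballQuotientUniformised_holds cmAbelianVarietyRealised_holds).WeilFaceAlgebraic K R₅)
    (hW₆ : (Model.picardCMUniverse exists_isReal_hodgeModel_holds hodgePQ_independent_of_hodgeModel_holds
      BallQuotient.ballQuotientUniformised_holds cmAbelianVarietyRealised_holds).WeilFaceAlgebraic K R₆)
    {P A : AbelianVariety ℂ} (hP : AbelianVariety.IsProductOf (fun B : AbelianVariety ℂ =>
      ∃ (E : Type) (_ : Field E) (_ : NumberField E) (_ : IsCMField E) (_ : E →+* (K : Type)) (Φ : CMType E)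
        (ι : 𝓞 E →+* End B) (θ : E →+* Module.End ℂ (complexBetti B.X 1)),
        IsCMTypeRealisation Φ B ι θ) P)
    (hA : AVDominatedBy A P) : HodgeConjectureFor A.dim A.X :=
  hodgeConjectureFor_of_avDominatedBy_isProductOf_of_weilFaceAlgebraic_on K
    ((show 6 ≤ 12 by decide).trans_eq (FaceCensus.eq_finrank_of_enum e)) {R₁, R₂, R₃, R₄, R₅, R₆} σ₀
    (hgen_duodecicC6C2 K e hmul hconj σ₀ {R₁, R₂, R₃, R₄, R₅, R₆} ⟨R₁, by simp, hR₁⟩ ⟨R₂, by simp, hR₂⟩ ⟨R₃, by simp, hR₃⟩ ⟨R₄, by simp, hR₄⟩ ⟨R₅, by simp, hR₅⟩ ⟨R₆, by simp, hR₆⟩)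
    (fun f hf => by
      simp only [Set.mem_insert_iff, Set.mem_singleton_iff] at hf
      rcases hf with rfl | rfl | rfl | rfl | rfl | rfl
      · exact hW₁
      · exact hW₂
      · exact hW₃
      · exact hW₄
      · exact hW₅
      · exact hW₆) hP hA

/-- **FIELD CLOSURE, type `ℤ/6 × ℤ/2` with `c = (3, 0)` (index `3`) — from AUTOMORPHISM data (the form a field-specific seat has).**
Same conclusion with the dictionary given on `Aut(K)`: a base embedding `σ₀`, a bijection `ε : Aut(K) ≃ Fin 12` multiplicative for
b30's table, the automorphism `c` inducing complex conjugation at `σ₀` with `ε c = 3`, and the faces described through `ε` (`σ₀ ∘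
g ∈ Rᵢ.Φ ↔ ε g ∈` type mask; place representatives `σ₀ ∘ g_p`, `σ₀ ∘ g_q` with the listed place masks). The enumeration of `GalT
K` is produced by `FaceCensus.exists_enum_of_autEnum` (`CorCM/FaceCensusCells.lean`). (FRAMING: conditional on the face periods;
`HC_CM` is not proved.) [cite: Shimura1998, §6.2 Theorem 3 and §6.1 Corollary of Theorem 2 (pp. 41–43)] [cite: Pohlmann1968, Thm.
1] [cite: Milne1999LefschetzClasses, Thm. 3.2 and Cor. 4.5] [cite: MumfordAV1970, §19 Thm. 1 and p. 169] -/
theorem hodgeConjectureFor_of_avDominatedBy_isProductOf_of_facePeriod_duodecicC6C2_aut (K : CMField) [IsGalois ℚ K]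
    (σ₀ : (K : Type) →+* ℂ) (ε : ((K : Type) ≃ₐ[ℚ] (K : Type)) ≃ Fin 12)
    (hε : ∀ g h : ((K : Type) ≃ₐ[ℚ] (K : Type)), ε (g * h) = Γ.mul (ε g) (ε h))
    (c : ((K : Type) ≃ₐ[ℚ] (K : Type))) (hc : σ₀.comp (c : (K : Type) →+* (K : Type)) = conjugate σ₀) (hεc : ε c = Γ.conj)
    (R₁ R₂ R₃ R₄ R₅ R₆ : Face K) (g₁ g₁' : ((K : Type) ≃ₐ[ℚ] (K : Type))) (g₂ g₂' : ((K : Type) ≃ₐ[ℚ] (K : Type))) (g₃ g₃' : ((K : Type) ≃ₐ[ℚ] (K : Type))) (g₄ g₄' : ((K : Type) ≃ₐ[ℚ] (K : Type))) (g₅ g₅' : ((K : Type) ≃ₐ[ℚ] (K : Type))) (g₆ g₆' : ((K : Type) ≃ₐ[ℚ] (K : Type)))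
    (hΦ₁ : ∀ g : ((K : Type) ≃ₐ[ℚ] (K : Type)),
      σ₀.comp (g : (K : Type) →+* (K : Type)) ∈ R₁.Φ.1 ↔ mem (ε g) 455 = true)
    (hp₁ : R₁.p = σ₀.comp (g₁ : (K : Type) →+* (K : Type))) (hp₁' : Γ.placeMask (ε g₁) = 9)
    (hq₁ : R₁.p' = σ₀.comp (g₁' : (K : Type) →+* (K : Type))) (hq₁' : Γ.placeMask (ε g₁') = 18)
    (hΦ₂ : ∀ g : ((K : Type) ≃ₐ[ℚ] (K : Type)),
      σ₀.comp (g : (K : Type) →+* (K : Type)) ∈ R₂.Φ.1 ↔ mem (ε g) 455 = true)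
    (hp₂ : R₂.p = σ₀.comp (g₂ : (K : Type) →+* (K : Type))) (hp₂' : Γ.placeMask (ε g₂) = 9)
    (hq₂ : R₂.p' = σ₀.comp (g₂' : (K : Type) →+* (K : Type))) (hq₂' : Γ.placeMask (ε g₂') = 36)
    (hΦ₃ : ∀ g : ((K : Type) ≃ₐ[ℚ] (K : Type)),
      σ₀.comp (g : (K : Type) →+* (K : Type)) ∈ R₃.Φ.1 ↔ mem (ε g) 455 = true)
    (hp₃ : R₃.p = σ₀.comp (g₃ : (K : Type) →+* (K : Type))) (hp₃' : Γ.placeMask (ε g₃) = 9)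
    (hq₃ : R₃.p' = σ₀.comp (g₃' : (K : Type) →+* (K : Type))) (hq₃' : Γ.placeMask (ε g₃') = 1152)
    (hΦ₄ : ∀ g : ((K : Type) ≃ₐ[ℚ] (K : Type)),
      σ₀.comp (g : (K : Type) →+* (K : Type)) ∈ R₄.Φ.1 ↔ mem (ε g) 462 = true)
    (hp₄ : R₄.p = σ₀.comp (g₄ : (K : Type) →+* (K : Type))) (hp₄' : Γ.placeMask (ε g₄) = 18)
    (hq₄ : R₄.p' = σ₀.comp (g₄' : (K : Type) →+* (K : Type))) (hq₄' : Γ.placeMask (ε g₄') = 2304)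
    (hΦ₅ : ∀ g : ((K : Type) ≃ₐ[ℚ] (K : Type)),
      σ₀.comp (g : (K : Type) →+* (K : Type)) ∈ R₅.Φ.1 ↔ mem (ε g) 462 = true)
    (hp₅ : R₅.p = σ₀.comp (g₅ : (K : Type) →+* (K : Type))) (hp₅' : Γ.placeMask (ε g₅) = 36)
    (hq₅ : R₅.p' = σ₀.comp (g₅' : (K : Type) →+* (K : Type))) (hq₅' : Γ.placeMask (ε g₅') = 1152)
    (hΦ₆ : ∀ g : ((K : Type) ≃ₐ[ℚ] (K : Type)),
      σ₀.comp (g : (K : Type) →+* (K : Type)) ∈ R₆.Φ.1 ↔ mem (ε g) 469 = true)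
    (hp₆ : R₆.p = σ₀.comp (g₆ : (K : Type) →+* (K : Type))) (hp₆' : Γ.placeMask (ε g₆) = 9)
    (hq₆ : R₆.p' = σ₀.comp (g₆' : (K : Type) →+* (K : Type))) (hq₆' : Γ.placeMask (ε g₆') = 1152)
    (h₁ : ∃ ι₁ : K →+* ℂ, R₁.Admissible ι₁ ∧ ∃ (V : HermSpace3 K ι₁) (σ : K →+* ℂ),
      (Model.picardCMUniverse exists_isReal_hodgeModel_holds hodgePQ_independent_of_hodgeModel_holds
        BallQuotient.ballQuotientUniformised_holds cmAbelianVarietyRealised_holds).PeriodNV ι₁ V K R₁.psi σ)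
    (h₂ : ∃ ι₁ : K →+* ℂ, R₂.Admissible ι₁ ∧ ∃ (V : HermSpace3 K ι₁) (σ : K →+* ℂ),
      (Model.picardCMUniverse exists_isReal_hodgeModel_holds hodgePQ_independent_of_hodgeModel_holds
        BallQuotient.ballQuotientUniformised_holds cmAbelianVarietyRealised_holds).PeriodNV ι₁ V K R₂.psi σ)
    (h₃ : ∃ ι₁ : K →+* ℂ, R₃.Admissible ι₁ ∧ ∃ (V : HermSpace3 K ι₁) (σ : K →+* ℂ),
      (Model.picardCMUniverse exists_isReal_hodgeModel_holds hodgePQ_independent_of_hodgeModel_holds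
        BallQuotient.ballQuotientUniformised_holds cmAbelianVarietyRealised_holds).PeriodNV ι₁ V K R₃.psi σ)
    (h₄ : ∃ ι₁ : K →+* ℂ, R₄.Admissible ι₁ ∧ ∃ (V : HermSpace3 K ι₁) (σ : K →+* ℂ),
      (Model.picardCMUniverse exists_isReal_hodgeModel_holds hodgePQ_independent_of_hodgeModel_holds
        BallQuotient.ballQuotientUniformised_holds cmAbelianVarietyRealised_holds).PeriodNV ι₁ V K R₄.psi σ)
    (h₅ : ∃ ι₁ : K →+* ℂ, R₅.Admissible ι₁ ∧ ∃ (V : HermSpace3 K ι₁) (σ : K →+* ℂ),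
      (Model.picardCMUniverse exists_isReal_hodgeModel_holds hodgePQ_independent_of_hodgeModel_holds
        BallQuotient.ballQuotientUniformised_holds cmAbelianVarietyRealised_holds).PeriodNV ι₁ V K R₅.psi σ)
    (h₆ : ∃ ι₁ : K →+* ℂ, R₆.Admissible ι₁ ∧ ∃ (V : HermSpace3 K ι₁) (σ : K →+* ℂ),
      (Model.picardCMUniverse exists_isReal_hodgeModel_holds hodgePQ_independent_of_hodgeModel_holds
        BallQuotient.ballQuotientUniformised_holds cmAbelianVarietyRealised_holds).PeriodNV ι₁ V K R₆.psi σ)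
    {P A : AbelianVariety ℂ} (hP : AbelianVariety.IsProductOf (fun B : AbelianVariety ℂ =>
      ∃ (E : Type) (_ : Field E) (_ : NumberField E) (_ : IsCMField E) (_ : E →+* (K : Type)) (Φ : CMType E)
        (ι : 𝓞 E →+* End B) (θ : E →+* Module.End ℂ (complexBetti B.X 1)),
        IsCMTypeRealisation Φ B ι θ) P)
    (hA : AVDominatedBy A P) : HodgeConjectureFor A.dim A.X := by
  obtain ⟨e, hmul, he⟩ := FaceCensus.exists_enum_of_autEnum Γ σ₀ ε hε
  have hconj : e conjT = Γ.conj := by rw [FaceCensus.conjT_eq_translate σ₀, ← hc, he, hεc]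
  exact hodgeConjectureFor_of_avDominatedBy_isProductOf_of_facePeriod_duodecicC6C2 K e hmul hconj σ₀ R₁ R₂ R₃ R₄ R₅ R₆
    (FaceCensus.reads_of_autEnum Γ e σ₀ ε he R₁ hΦ₁ hp₁ hp₁' hq₁ hq₁')
    (FaceCensus.reads_of_autEnum Γ e σ₀ ε he R₂ hΦ₂ hp₂ hp₂' hq₂ hq₂')
    (FaceCensus.reads_of_autEnum Γ e σ₀ ε he R₃ hΦ₃ hp₃ hp₃' hq₃ hq₃')
    (FaceCensus.reads_of_autEnum Γ e σ₀ ε he R₄ hΦ₄ hp₄ hp₄' hq₄ hq₄')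
    (FaceCensus.reads_of_autEnum Γ e σ₀ ε he R₅ hΦ₅ hp₅ hp₅' hq₅ hq₅')
    (FaceCensus.reads_of_autEnum Γ e σ₀ ε he R₆ hΦ₆ hp₆ hp₆' hq₆ hq₆')
    h₁ h₂ h₃ h₄ h₅ h₆ hP hA

end Summit.HodgeConjecture.CorCM.DuodecicFaceTransport.C6C2


end
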